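import Literature.NumberTheory.PAdicHodge.AxSenTate
import Literature.NumberTheory.GaloisRepresentations.LabelledHodgeTateWeights
import Literature.NumberTheory.GaloisRepresentations.PadicAlgebraOfLocalField
import Literature.NumberTheory.GaloisRepresentations.LocalGaloisGroup
import Mathlib.Algebra.Ring.Action.Field
import Mathlib.LinearAlgebra.Eigenspace.Basic
import Mathlib.NumberTheory.Padics.Complex
import HarnessLib

/-!
# Sen's operator `Θ` on `V ⊗ ℂ_F`, the `τ`-labelled Sen conditions, and `Θ_τ(ρ|_{Γ_{K_v}})`

Let `F` be a non-archimedean local field of characteristic `0` and residue characteristic `p`,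
`ℂ_F = CompletedAlgClosure F` the completion of `F̄` with its continuous `Γ_F`-action
(`CompletedAlgClosure`, `AxSenTate`), `χ_F : Γ_F → ℤ_pˣ` the cyclotomic character and
`H_F = ker χ_F = Gal(F̄/F(μ_{p^∞}))`.  For a continuous `E`-linear representation `ρ` of `Γ_F` on `M`
(`E ⊇ ℚ_p` a coefficient field: a finite `E/ℚ_p`, or `E = ℚ̄_p = PadicAlgCl p` for framed
representations) SEN'S THEORY (Sen 1980; read here from Brinon–Conrad §15.1 and Berger 2004 §2) attaches to the
`ℂ_F`-semilinear representation `W = M ⊗_{ℚ_p} ℂ_F` its `K_∞ = F(μ_{p^∞})`-structure of finite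
vectors `D_Sen(W) ⊆ W^{H_F}` and a canonical `ℂ_F`-linear endomorphism, **Sen's operator**
`Θ = Θ_{Sen}`, "the derivative at `γ = 1` of the action of `Γ_F/H_F ≅ ℤ_pˣ`":
`γ(x) = exp(log χ(γ) · Θ)(x)` for `x ∈ D_Sen(W)` and `γ` near `1` (Brinon–Conrad Thm. 15.1.7), i.e.
`Θ(x) = lim_{γ → 1} (γ x - x)/log χ(γ)` (loc. cit. (15.1.3)).  Its eigenvalues are the generalized
Hodge–Tate weights; `W` is Hodge–Tate iff `Θ` is semisimple with integer eigenvalues; `Θ = 0` iff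
`W` is trivial iff (Sen 1973) the inertia group acts on `M` through a finite quotient.

This file makes that theory available to the tree in the form the route `SenNullAlignment` of
the summit `Langlands` asked for (definition request `defn-SenOperatorAt`): an operator
`Θ_τ(ρ|_{Γ_{K_v}})` for `ρ : Γ_K →ₜ* GL_n(ℚ̄_ℓ)`, `v ∣ ℓ`, `τ : K_v → ℚ̄_ℓ`, the predicates
"Sen-null at `τ`" / "Hodge–Tate at `τ`", the `τ`-weights, and Sen's finiteness theorem.

## Main definitions

* `PeriodRingData.ringAct 𝔅 b = id ⊗ (b · )` and `PeriodRingData.labelComponent 𝔅 τ` (the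
  `τ`-component `W_τ = {x | (id ⊗ f) x = τ f • x}` of `M ⊗_P B`) — pure algebra on `M ⊗_P B`,
  dot-notation extensions of the accepted `PeriodRingData` (`LabelledHodgeTateWeights`).
* `cPeriodRingData F p : PeriodRingData Γ_F ℚ_p F` — **`ℂ_F` as a period ring** (Fontaine's
  `(ℚ_p, Γ_F)`-regular ring `C`), regularity PROVED from Ax–Sen–Tate; trivial filtration `cFil`.
  Its admissible representations are the `ℂ`-admissible ones.
* `finiteVectors π H` (vectors fixed by `H` whose orbit spans a finite-dimensional subspace);
  `Sen.kerCyclotomic F p = H_F`; `Sen.chiQ F p g = χ_F(g) ∈ ℚ_p`;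
  `Sen.DSen p ρ` — **`D_Sen(W)`** as the finite vectors of `W^{H_F}` (Brinon–Conrad Thm. 15.1.5);
  `Sen.endC F p E M` — the `ℂ_F`-linear `E`-linear endomorphisms of `W` (a centralizer
  subalgebra); `Sen.diffQuot p ρ x g = (χ_F(g) - 1)⁻¹ • (g x - x)`.
* `IsSenOperator ρ Θ` — **Sen's characterisation**: for every `x ∈ D_Sen(W)` and every
  `E`-linear functional `l` of `W`, `l((χ_F(g) - 1)⁻¹ (g x - x)) → l(Θ x)` as `g → 1` in `Γ_F`
  with `χ_F(g) ≠ 1` (the weak form of (15.1.3), `log χ(γ)` replaced by the asymptotically equal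
  `χ(γ) - 1`; no topology on the tensor product is needed).
* `senOperator p ρ : Sen.endC F p E M` — **Sen's operator, pinned by specification**:
  `Classical.epsilon (IsSenOperator ρ)`; `senEnd p ρ` its underlying endomorphism.
* Labelled, for `τ : F →+* E`: `senOperatorAt p ρ τ` (**`Θ_τ`**, the restriction of `Θ` to
  `W_τ`), `IsSenNull p ρ` (`Θ = 0`), `IsSenNullAt p ρ τ` (`Θ_τ = 0`), `IsHodgeTateAt p ρ τ`
  (`W_τ ≤ ⨆_{i ∈ ℤ} ker(Θ - i)`), `senWeightsAt p ρ τ : Set E` (eigenvalues of `Θ` on `W_τ`).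
* NAMED FACTS (D-0014), both for `ℚ̄_p`-framed `r : Γ_F →ₜ* GL_n(ℚ̄_p)` and the canonical
  `ℚ_p`-structure `LocalField.padicAlgebra F p hp`:
  `SenOperatorExistsUnique` (Sen 1980; Brinon–Conrad Thm. 15.1.2, 15.1.5, 15.1.7: exactly one
  `Θ` has Sen's property) and `SenFiniteness` (Sen 1973; Berger 2004 §1–§2: `Θ = 0 ↔ r(I_F)`
  finite).
* Global wrappers (namespace `FramedGaloisRep`, as for `labelledHodgeTateWeightsAt`): for `K` a
  number field, `ρ : FramedGaloisRep K (PadicAlgCl ℓ) n`, a finite place `v`, a `ℚ_ℓ`-structure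
  `alg` of `K_v` and `τ : K_v →+* ℚ̄_ℓ`: `ρ.senOperatorAt v alg τ` = **`Θ_τ(ρ|_{Γ_{K_v}})`**,
  `ρ.IsSenNullAtPlace v alg`, `ρ.IsSenNullAt v alg τ`, `ρ.IsHodgeTateAt v alg τ`,
  `ρ.senWeightsAt v alg τ`, and `isSenNullAtPlace_iff_finite` / `isSenNullAt_of_finite` (Sen's
  finiteness at `v ∣ ℓ` for `LocalField.adicCompletionPadicAlgebra v ℓ hv`, from `SenFiniteness`).

## Results (all `sorry`-free; axioms ⊆ {propext, Classical.choice, Quot.sound})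

* Fontaine regularity of `ℂ_F` (`cPeriodRingData`), `Sen.coeffD_le_DSen` (`W^{Γ_F} ⊆ D_Sen`),
  `Sen.ringAct_mem_endC`, `senEnd_mem_labelComponent` (`Θ` preserves `W_τ`),
  `isSenNullAt_iff_senOperatorAt_eq_zero`, `IsSenNull.isSenNullAt`, `IsSenNullAt.isHodgeTateAt`,
  `IsSenNullAt.senWeightsAt_subset`, `mem_senWeightsAt_iff`;
* `IsSenOperator.apply_eq_zero_of_mem_coeffD`: a Sen operator kills `W^{Γ_F}` (easy half of
  Brinon–Conrad Ex. 15.5.4 (1)), given that `χ_F` is not locally constant at `1`;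
* under the facts: `isSenOperator_senOperator`, `IsSenOperator.eq_senOperator` (the pinned
  operator is THE Sen operator), `isSenNullAt_of_finite_image_inertia`.

## Design choices

* **Pinning by specification** (as the accepted `FontaineDpst.fontainePst`).  Sen's operator is the
  object of a theorem (Sen's decompletion, Brinon–Conrad §14–§15) whose formalisation is a theory of its
  own (Tate's normalised traces are in the tree, the descent `H¹(H_F, GL_d(ℂ_F)) = 1` and the
  decompletion are not).  The characterisation `IsSenOperator` is categorical under Sen's theorems
  (`D_Sen` spans `W` over `ℂ_F`, Thm. 15.1.2, so a `ℂ_F`-linear `Θ` is determined by its values on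
  `D_Sen`), hence `Classical.epsilon` names THE operator under `SenOperatorExistsUnique`, and every
  statement about `senOperator` is relative to that fact — never weaker than the intended one.
* **Finite vectors over `E`.**  Brinon–Conrad Thm. 15.1.5 characterises `D_Sen(W) ⊆ W^{H}` by
  finiteness of the `K`-span of the `Γ`-orbit; we use the `E`-span (the `E`-structure of
  `M ⊗_{ℚ_p} ℂ_F` is an instance, the `F`-structure is not).  For `[E : ℚ_p] < ∞` both say that the
  `ℚ_p`-span of the orbit is finite-dimensional; for `E = ℚ̄_p` and `ρ` with a model over a finite
  `E₀` (always, for framed `ρ`, by compactness) the same holds by extracting coordinates along an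
  `E₀`-basis of `ℚ̄_p`, and `D_Sen(W) = D_Sen(W_{E₀}) ⊗_{E₀} ℚ̄_p`.
* **Weak derivative.**  (15.1.3) is a limit in `D_Sen ≅ K_∞^d`; the difference quotients of a
  finite vector `x` live in the finite-dimensional `E`-span `U_x` of its orbit, and convergence
  there is convergence after every functional (functionals of `W` restrict to all of `U_x^*`).  So
  `IsSenOperator` needs topologies on `Γ_F` (Krull) and `E` only.  `log χ(γ)/(χ(γ) - 1) → 1`, so
  the quotient by `χ(γ) - 1` has the same limit and no `p`-adic logarithm is needed.
* **Coefficients `E = ℚ̄_p` and labels.**  As in `LabelledHodgeTateWeights`, `W = M ⊗_{ℚ_p} ℂ_F`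
  with `E` acting through `M` and `F` through `ℂ_F`; `Θ` is `E`-linear (functoriality,
  Brinon–Conrad Cor. 15.1.10) and `ℂ_F`-linear, so it preserves each `W_τ`; when `E` splits `F`,
  `W = ⊕_τ W_τ` (accepted `CoeffEigen.iSup_eigenSub_eq_top`) and `Θ = ⊕ Θ_τ`.  `Θ_τ` lives on
  `W_τ` (a module over `ℂ_F ⊗_{F,τ} E`, not a field): its descent to an `n × n` matrix over
  `ℚ̄_ℓ` (well defined up to conjugacy through `D_Sen`) and the Sen polynomial `det(X - Θ_τ)`
  with its multiplicities are NOT provided; `senWeightsAt` is the SET of eigenvalues.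
* **`ℚ_p`-structure of `F`.**  Definitions take the ambient `[Algebra ℚ_[p] F]` (global wrappers:
  the datum `alg`, as `labelledHodgeTateWeightsAt`); the two facts are stated for the canonical
  `LocalField.padicAlgebra` only.
* No construction of `D_Sen` as a `K_∞`-space, of `B_Sen`, or of `Θ` on `B_dR⁺`-representations
  (Fontaine's `D_dif`); no comparison `senWeightsAt = labelledHodgeTateWeights` for de Rham `ρ`
  (a theorem of the theory: Hodge–Tate ⇒ `Θ` semisimple with the Hodge–Tate weights as
  eigenvalues); no proof that `χ_F` is not locally constant (hypothesis `NeBot` where used).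

## References

* S. Sen, *Continuous cohomology and p-adic Galois representations*, Invent. Math. 62 (1980),
  89–116 — the ORIGINAL source of the descent/decompletion, the operator `φ`, its characteristic
  polynomial over `K`, "Hodge–Tate iff `φ` semisimple integral" and the Lie-algebra theorem;
  paywalled (acquisition request acq-06291), NOT consulted: every theorem number quoted in this
  file is Brinon–Conrad's or Berger's, whose texts were read. [Sen1980]
* S. Sen, *Lie algebras of Galois groups arising from Hodge–Tate modules*, Ann. of Math. 97
  (1973), 160–170 — original source of "`ℂ`-admissible iff the inertia group acts through a
  finite quotient" (as reported by Berger 2004 §1 and Brinon–Conrad Thm. 2.2.7 for characters);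
  paywalled (acq-06283), not consulted. [Sen1973]
* O. Brinon, B. Conrad, *CMI Summer School notes on p-adic Hodge theory* (2009), §15.1:
  Thm. 15.1.2, Thm. 15.1.5, Thm. 15.1.7, (15.1.3), Cor. 15.1.10, Exercises 15.5.3–15.5.4; Thm. 2.2.7
  (Tate–Sen). [BrinonConrad2009]
* L. Berger, *An introduction to the theory of p-adic representations* (2004), §2 "The field `ℂ_p`
  and the theory of Sen" (`D_Sen`, `Θ_V = log(γ)/log_p χ(γ)`, generalized Hodge–Tate weights) and §1
  "Fontaine's strategy" (`ℂ_p`-admissible iff potentially unramified, Sen). [BergerLaurent2004Introduction]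
* S. Patrikis, *Variations on a theorem of Tate* (2019), §2.3.1, §2.7.1 (labels `τ`,
  Hodge–Tate–Sen weights of `ℚ̄_ℓ`-representations). [Patrikis2019]
* K. Buzzard, T. Gee, *The conjectural connections …* (2014), Rem. 3.2.3. [BuzzardGeeLMS2014]
* J.-M. Fontaine, Y. Ouyang, *Theory of p-adic Galois representations*, §3.1 (`C^{G_K} = K`).
  [FontaineOuyang2022]
* J. Tate, *p-divisible groups* (1967), §3.3. [Tate1967]
-/

noncomputable section

open scoped TensorProduct
open Field IsDedekindDomain TensorProduct Filter ValuativeRel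
open scoped _root_.Topology

universe u v v' w

/-! ### Algebraic helpers on `M ⊗_P B` for a period-ring datum -/

namespace Literature.NumberTheory.GaloisRepresentations.PeriodRingData

section RingAct

variable {Γ : Type u} [Group Γ] {P : Type v} {F : Type v'} [Field P] [Field F] [Algebra P F]
  (E : Type*) [Field E] [Algebra P E]
  (M : Type*) [AddCommGroup M] [Module E M] [Module P M] [IsScalarTower P E M]
  (𝔅 : PeriodRingData.{u, v, v', w} Γ P F)

/-- The action of `b ∈ B` on `M ⊗_P B` through the right factor, `id ⊗ (b · )`, as an `E`-linear
map (`E` acting through `M`): the `B`-module structure of `M ⊗_P B` made explicit (Mathlib's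
`TensorProduct.leftModule` only provides the `E`-structure).  `baseAct f` is `ringAct` of
`algebraMap F B f` (`baseAct_eq_ringAct`). [folklore] -/
def ringAct (b : 𝔅.B) : M ⊗[P] 𝔅.B →ₗ[E] M ⊗[P] 𝔅.B :=
  AlgebraTensorModule.map LinearMap.id (LinearMap.mulLeft P b)

/-- Unfolding lemma for `ringAct` on pure tensors. [folklore] -/
@[simp] lemma ringAct_tmul (b : 𝔅.B) (m : M) (c : 𝔅.B) :
    𝔅.ringAct E M b (m ⊗ₜ[P] c) = m ⊗ₜ[P] (b * c) := rfl

/-- `baseAct f = ringAct (algebraMap F B f)`. [folklore] -/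
lemma baseAct_eq_ringAct (f : F) : 𝔅.baseAct E M f = 𝔅.ringAct E M (algebraMap F 𝔅.B f) := by
  refine TensorProduct.AlgebraTensorModule.ext fun m c => ?_
  rw [baseAct_tmul, ringAct_tmul, Algebra.smul_def]

/-- The **`τ`-component** `W_τ = {x | (id ⊗ f) x = τ(f) • x for all f ∈ F}` of the
`F ⊗_P E`-module `W = M ⊗_P B`, for `τ : F →+* E` (so that `labelD ρ τ = coeffD ρ ⊓ labelComponent τ`).
When `E` contains the `[F : P]` embeddings of the finite separable extension `F/P`,
`F ⊗_P E ≅ ∏_τ E` and `W = ⊕_τ W_τ` (tree `CoeffEigen.iSup_eigenSub_eq_top`).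
Ref: Patrikis 2019, §2.3.1 (`e_τ`). [cite: Patrikis2019, §2.3.1] -/
def labelComponent (τ : F →+* E) : Submodule E (M ⊗[P] 𝔅.B) where
  carrier := {x | ∀ f : F, 𝔅.baseAct E M f x = τ f • x}
  add_mem' := by
    intro x y hx hy f
    rw [map_add, hx f, hy f, smul_add]
  zero_mem' := fun f => by rw [map_zero, smul_zero]
  smul_mem' := by
    intro c x hx f
    rw [map_smul, hx f, smul_comm]

/-- Membership in the `τ`-component. [folklore] -/
lemma mem_labelComponent_iff (τ : F →+* E) (x : M ⊗[P] 𝔅.B) :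
    x ∈ 𝔅.labelComponent E M τ ↔ ∀ f : F, 𝔅.baseAct E M f x = τ f • x := Iff.rfl

/-- An `E`-linear endomorphism commuting with the `B`-action preserves every `τ`-component.
[folklore] -/
lemma map_mem_labelComponent {Θ : Module.End E (M ⊗[P] 𝔅.B)}
    (hΘ : ∀ b : 𝔅.B, 𝔅.ringAct E M b * Θ = Θ * 𝔅.ringAct E M b) (τ : F →+* E)
    {x : M ⊗[P] 𝔅.B} (hx : x ∈ 𝔅.labelComponent E M τ) : Θ x ∈ 𝔅.labelComponent E M τ := by
  intro f
  rw [baseAct_eq_ringAct, ← Module.End.mul_apply, hΘ, Module.End.mul_apply, ← baseAct_eq_ringAct,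
    hx f, map_smul]

end RingAct

end Literature.NumberTheory.GaloisRepresentations.PeriodRingData

namespace Literature.NumberTheory.PAdicHodge

open Literature.NumberTheory.GaloisRepresentations
open Literature.NumberTheory.GaloisRepresentations.IsNonarchimedeanLocalField

/-! ### `ℂ_F` as a period-ring datum: `ℂ`-admissible representations -/

section CDatum

variable (F : Type) [Field F] [ValuativeRel F] [TopologicalSpace F] [IsNonarchimedeanLocalField F]
  (p : ℕ) [Fact p.Prime] [Algebra ℚ_[p] F]

/-- The **trivial filtration** on `ℂ_F` by `F`-subspaces: `Fil^i = ℂ_F` for `i ≤ 0` and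
`Fil^i = 0` for `i > 0` (Sen's ring carries no Hodge filtration: `ℂ_F = gr⁰ B_HT = B_dR⁺/t`).
[folklore] -/
def cFil (i : ℤ) : Submodule F (CompletedAlgClosure F) := if i ≤ 0 then ⊤ else ⊥

/-- Unfolding lemma for `cFil` in non-positive degrees. [folklore] -/
@[simp] theorem cFil_of_nonpos {i : ℤ} (hi : i ≤ 0) : cFil F i = ⊤ := if_pos hi

/-- Unfolding lemma for `cFil` in positive degrees. [folklore] -/
@[simp] theorem cFil_of_pos {i : ℤ} (hi : 0 < i) : cFil F i = ⊥ := if_neg (not_le.2 hi)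

variable [CharZero F]

/-- **`ℂ_F` as a period ring** (Fontaine's `(ℚ_p, Γ_F)`-regular ring `C = \widehat{F̄}`): the
period-ring datum with `B = ℂ_F = CompletedAlgClosure F`, its continuous `Γ_F`-action, invariant
field `ℂ_F^{Γ_F} = F` (Ax–Sen–Tate, `CompletedAlgClosure.fixedPoints_eq_range_algebraMap`),
Fontaine's regularity conditions (ii) (`b/c` invariant ⇒ `b/c ∈ F`, again Ax–Sen–Tate) and (iii)
(`ℂ_F` is a field), and the trivial filtration `cFil` (`Fil^i = ℂ_F` for `i ≤ 0`, `0` for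
`i > 0`).  Its admissible representations (`PeriodRingData.IsAdmissible`) are Fontaine's
**`ℂ`-admissible** ones: `dim_F (ℂ_F ⊗_{ℚ_p} V)^{Γ_F} = dim_{ℚ_p} V`, i.e. `ℂ_F ⊗ V` is a trivial
`ℂ_F`-semilinear representation (by Sen's theorem these are exactly the `V` on which the inertia
group acts through a finite quotient, `SenFiniteness`).  The `ℚ_p`-algebra structure of `F` is the
ambient instance (the canonical `LocalField.padicAlgebra` in Sen's theory).
[cite: FontaineOuyang2022, §3.1 (C^{G_K} = K)] [cite: Tate1967, §3.3 Theorem 1]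
[cite: BergerLaurent2004Introduction, §1 (Fontaine's strategy: B = C_p, C_p-admissible representations)] -/
def cPeriodRingData : PeriodRingData.{0, 0, 0, 0} (absoluteGaloisGroup F) ℚ_[p] F where
  B := CompletedAlgClosure F
  invariants_eq := CompletedAlgClosure.fixedPoints_eq_range_algebraMap
  exists_smul_eq b c hc h := by
    have hfix : b / c ∈ {x : CompletedAlgClosure F | ∀ σ : absoluteGaloisGroup F, σ • x = x} := by
      intro σ
      have hσc : σ • c ≠ 0 := fun h0 => hc (by simpa using congrArg (fun y => σ⁻¹ • y) h0)
      rw [smul_div₀' σ b c, div_eq_div_iff hσc hc]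
      exact h σ
    rw [CompletedAlgClosure.fixedPoints_eq_range_algebraMap] at hfix
    obtain ⟨e, he⟩ := hfix
    exact ⟨e, by rw [Algebra.smul_def, he, div_mul_cancel₀ b hc]⟩
  isUnit_of_smul_mem b hb _ := isUnit_iff_ne_zero.mpr hb
  fil := cFil F
  fil_antitone i j hij := by
    by_cases hj : j ≤ 0
    · rw [cFil_of_nonpos F hj, cFil_of_nonpos F (hij.trans hj)]
    · rw [cFil_of_pos F (not_le.1 hj)]
      exact bot_le
  mul_mem_fil i j x y hx hy := by
    by_cases hi : i ≤ 0
    · by_cases hj : j ≤ 0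
      · rw [cFil_of_nonpos F (add_nonpos hi hj)]
        exact Submodule.mem_top
      · rw [cFil_of_pos F (not_le.1 hj), Submodule.mem_bot] at hy
        rw [hy, mul_zero]
        exact zero_mem _
    · rw [cFil_of_pos F (not_le.1 hi), Submodule.mem_bot] at hx
      rw [hx, zero_mul]
      exact zero_mem _
  one_mem_fil_zero := by
    rw [cFil_of_nonpos F le_rfl]
    exact Submodule.mem_top
  smul_mem_fil σ i x hx := by
    by_cases hi : i ≤ 0
    · rw [cFil_of_nonpos F hi]
      exact Submodule.mem_top
    · rw [cFil_of_pos F (not_le.1 hi), Submodule.mem_bot] at hx ⊢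
      rw [hx, smul_zero]
  iSup_fil := eq_top_iff.2 (le_iSup_of_le 0 (by rw [cFil_of_nonpos F le_rfl]))
  iInf_fil := eq_bot_iff.2 (iInf_le_of_le 1 (by rw [cFil_of_pos F zero_lt_one]))

/-- The period ring of `cPeriodRingData` is `ℂ_F` (definitionally). [folklore] -/
@[simp] theorem cPeriodRingData_B : (cPeriodRingData F p).B = CompletedAlgClosure F := rfl

/-- The filtration of `cPeriodRingData` is the trivial one. [folklore] -/
theorem cPeriodRingData_fil : (cPeriodRingData F p).fil = cFil F := rfl

end CDatum


/-! ### Finite vectors of a representation -/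

section FiniteVectors

variable {Γ : Type*} [Group Γ] {E : Type*} [Field E] {W : Type*} [AddCommGroup W] [Module E W]

/-- The `E`-span of the `Γ`-orbit of `x` under the representation `π`. [folklore] -/
def orbitSpan (π : Representation E Γ W) (x : W) : Submodule E W :=
  Submodule.span E (Set.range fun g : Γ => π g x)

/-- The orbit of `x` lies in its orbit span. [folklore] -/
lemma apply_mem_orbitSpan (π : Representation E Γ W) (x : W) (g : Γ) : π g x ∈ orbitSpan π x :=
  Submodule.subset_span ⟨g, rfl⟩

/-- `x` lies in the span of its orbit. [folklore] -/
lemma mem_orbitSpan (π : Representation E Γ W) (x : W) : x ∈ orbitSpan π x := by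
  simpa using apply_mem_orbitSpan π x 1

/-- The orbit span of a sum. [folklore] -/
lemma orbitSpan_add_le (π : Representation E Γ W) (x y : W) :
    orbitSpan π (x + y) ≤ orbitSpan π x ⊔ orbitSpan π y := by
  refine Submodule.span_le.2 (Set.range_subset_iff.2 fun g => ?_)
  rw [SetLike.mem_coe, map_add]
  exact Submodule.add_mem_sup (apply_mem_orbitSpan π x g) (apply_mem_orbitSpan π y g)

/-- The orbit span of a scalar multiple. [folklore] -/
lemma orbitSpan_smul_le (π : Representation E Γ W) (c : E) (x : W) :
    orbitSpan π (c • x) ≤ orbitSpan π x := by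
  refine Submodule.span_le.2 (Set.range_subset_iff.2 fun g => ?_)
  rw [SetLike.mem_coe, map_smul]
  exact Submodule.smul_mem _ c (apply_mem_orbitSpan π x g)

/-- The orbit span of `0` is `0`. [folklore] -/
lemma orbitSpan_zero (π : Representation E Γ W) : orbitSpan π 0 = ⊥ := by
  rw [orbitSpan, Submodule.span_eq_bot]
  rintro _ ⟨g, rfl⟩
  exact map_zero (π g)

/-- The **finite vectors** of the representation `π` relative to the subgroup `H ≤ Γ`: the
vectors fixed by `H` whose `Γ`-orbit spans a finite-dimensional `E`-subspace — an
`E`-submodule.  For `π` the diagonal action on `W = ℂ_F ⊗ V` and `H = H_F = ker χ_F` these are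
Sen's finite vectors `D_Sen(W)` (Brinon–Conrad, Thm. 15.1.5: "`D_Sen(W)` is the `K_∞`-subspace of
points of `Ŵ_∞ = W^H` whose `Γ`-orbit has `K`-span of finite `K`-dimension").
[cite: BrinonConrad2009, Thm. 15.1.5] -/
def finiteVectors (π : Representation E Γ W) (H : Subgroup Γ) : Submodule E W where
  carrier := {x | (∀ h ∈ H, π h x = x) ∧ FiniteDimensional E (orbitSpan π x)}
  add_mem' := by
    rintro x y ⟨hx, hx'⟩ ⟨hy, hy'⟩
    refine ⟨fun h hh => by rw [map_add, hx h hh, hy h hh], ?_⟩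
    haveI := hx'
    haveI := hy'
    exact Submodule.finiteDimensional_of_le (orbitSpan_add_le π x y)
  zero_mem' := ⟨fun h _ => map_zero _, by rw [orbitSpan_zero]; infer_instance⟩
  smul_mem' := by
    rintro c x ⟨hx, hx'⟩
    refine ⟨fun h hh => by rw [map_smul, hx h hh], ?_⟩
    haveI := hx'
    exact Submodule.finiteDimensional_of_le (orbitSpan_smul_le π c x)

/-- Membership in the finite vectors. [folklore] -/
lemma mem_finiteVectors_iff (π : Representation E Γ W) (H : Subgroup Γ) (x : W) :
    x ∈ finiteVectors π H ↔ (∀ h ∈ H, π h x = x) ∧ FiniteDimensional E (orbitSpan π x) :=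
  Iff.rfl

/-- Invariant vectors are finite vectors (their orbit is a point). [folklore] -/
lemma mem_finiteVectors_of_forall_eq (π : Representation E Γ W) (H : Subgroup Γ) {x : W}
    (hx : ∀ g : Γ, π g x = x) : x ∈ finiteVectors π H := by
  refine ⟨fun h _ => hx h, ?_⟩
  have hle : orbitSpan π x ≤ Submodule.span E {x} := by
    refine Submodule.span_le.2 (Set.range_subset_iff.2 fun g => ?_)
    rw [hx g]
    exact Submodule.subset_span rfl
  exact Submodule.finiteDimensional_of_le hle

end FiniteVectors

/-! ### The cyclotomic character: `H_F = ker χ_F` and `χ_F` in `ℚ_p` -/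

namespace Sen

section Cyclotomic

variable (F : Type) [Field F] (p : ℕ) [Fact p.Prime]

/-- **`H_F = Gal(F̄/F(μ_{p^∞}))`**, the kernel of the cyclotomic character `χ_F : Γ_F → ℤ_pˣ`
(`GaloisRep.cyclotomicCharacter F p`); `Γ_F/H_F = Gal(F(μ_{p^∞})/F)`.  Sen's theory is run for
`ψ = χ_F` and `K_∞ = F(μ_{p^∞})` ("the traditional case", Brinon–Conrad §15.1).
[cite: BrinonConrad2009, §15 (setup) and Thm. 15.1.2] -/
def kerCyclotomic : Subgroup (absoluteGaloisGroup F) :=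
  (GaloisRep.cyclotomicCharacter F p).toMonoidHom.ker

variable {F p} in
/-- Membership in `H_F`: `χ_F(g) = 1`. [folklore] -/
lemma mem_kerCyclotomic_iff (g : absoluteGaloisGroup F) :
    g ∈ kerCyclotomic F p ↔ GaloisRep.cyclotomicCharacter F p g = 1 := Iff.rfl

/-- `χ_F(g)` as an element of `ℚ_p` (through `ℤ_pˣ ⊆ ℤ_p ⊆ ℚ_p`). [folklore] -/
def chiQ (g : absoluteGaloisGroup F) : ℚ_[p] :=
  (((GaloisRep.cyclotomicCharacter F p g : ℤ_[p]ˣ) : ℤ_[p]) : ℚ_[p])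

/-- `chiQ 1 = 1`. [folklore] -/
@[simp] lemma chiQ_one : chiQ F p 1 = 1 := by
  simp [chiQ]

variable {F p} in
/-- `chiQ g = 1 ↔ g ∈ H_F`. [folklore] -/
lemma chiQ_eq_one_iff (g : absoluteGaloisGroup F) : chiQ F p g = 1 ↔ g ∈ kerCyclotomic F p := by
  rw [mem_kerCyclotomic_iff, chiQ, ← PadicInt.coe_one]
  constructor
  · intro h
    exact Units.ext (PadicInt.ext h)
  · intro h
    rw [h, Units.val_one]

end Cyclotomic

/-! ### `ℂ_F`-linear endomorphisms of `W = M ⊗_{ℚ_p} ℂ_F` -/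

section EndC

variable (F : Type) [Field F] [ValuativeRel F] [TopologicalSpace F] [IsNonarchimedeanLocalField F]
  [CharZero F] (p : ℕ) [Fact p.Prime] [Algebra ℚ_[p] F]
  (E : Type*) [Field E] [Algebra ℚ_[p] E]
  (M : Type*) [AddCommGroup M] [Module E M] [Module ℚ_[p] M] [IsScalarTower ℚ_[p] E M]

/-- The `E`-algebra of **`ℂ_F`-linear `E`-linear endomorphisms** of `W = M ⊗_{ℚ_p} ℂ_F`: the
centralizer in `End_E(W)` of the `ℂ_F`-action `PeriodRingData.ringAct` on the right factor (the
`E`-structure acts through `M`).  Sen's operator `Θ_W` is `ℂ_F`-linear and, being functorial in `W`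
(Brinon–Conrad Cor. 15.1.10(1)), commutes with the `E`-action; it is sought in this algebra.
[cite: BrinonConrad2009, Thm. 15.1.7 and Cor. 15.1.10] -/
def endC : Subalgebra E (Module.End E (M ⊗[ℚ_[p]] (cPeriodRingData F p).B)) :=
  Subalgebra.centralizer E (Set.range ((cPeriodRingData F p).ringAct E M))

variable {F p E M} in
/-- Membership in `endC`: commuting with every `id ⊗ (b · )`. [folklore] -/
lemma mem_endC_iff (Θ : Module.End E (M ⊗[ℚ_[p]] (cPeriodRingData F p).B)) :
    Θ ∈ endC F p E M ↔ ∀ b : (cPeriodRingData F p).B,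
      (cPeriodRingData F p).ringAct E M b * Θ = Θ * (cPeriodRingData F p).ringAct E M b := by
  rw [endC, Subalgebra.mem_centralizer_iff]
  constructor
  · intro h b
    exact h _ ⟨b, rfl⟩
  · rintro h _ ⟨b, rfl⟩
    exact h b

variable {F p E M} in
/-- The `ℂ_F`-action itself is `ℂ_F`-linear (`ℂ_F` is commutative). [folklore] -/
lemma ringAct_mem_endC (b : (cPeriodRingData F p).B) :
    (cPeriodRingData F p).ringAct E M b ∈ endC F p E M := by
  refine (mem_endC_iff _).2 fun c => TensorProduct.AlgebraTensorModule.ext fun m d => ?_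
  simp only [Module.End.mul_apply, PeriodRingData.ringAct_tmul, mul_left_comm]

end EndC

end Sen

/-! ### Sen's operator: the characterisation and the pinned operator -/

section Sen

variable {F : Type} [Field F] [ValuativeRel F] [TopologicalSpace F] [IsNonarchimedeanLocalField F]
  [CharZero F] (p : ℕ) [Fact p.Prime] [Algebra ℚ_[p] F]
  {E : Type*} [Field E] [Algebra ℚ_[p] E] [TopologicalSpace E]
  {M : Type*} [AddCommGroup M] [Module E M] [Module ℚ_[p] M] [IsScalarTower ℚ_[p] E M]
  [TopologicalSpace M] (ρ : GaloisRep F E M)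

namespace Sen

/-- **Sen's finite vectors `D_Sen(ℂ_F ⊗ V)`** of the `E`-linear representation `ρ` of `Γ_F` on
`V = M`: the elements of `W = M ⊗_{ℚ_p} ℂ_F` (diagonal action `PeriodRingData.coeffTensorRep` of
the datum `cPeriodRingData`) fixed by `H_F = ker χ_F` whose `Γ_F`-orbit spans a
finite-dimensional `E`-subspace.  By Sen's theorems (Brinon–Conrad Thm. 15.1.2 and Thm. 15.1.5,
for `V` finite-dimensional over `ℚ_p`; the literature phrases the finiteness with the `F`-span,
which for `[E : ℚ_p] < ∞` is equivalent since both amount to finiteness of the `ℚ_p`-span) this is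
the `K_∞ = F(μ_{p^∞})`-structure `D_Sen(W)` of `W`: a `K_∞`-subspace of `W^{H_F}` of dimension
`dim_{ℂ_F} W` with `ℂ_F ⊗_{K_∞} D_Sen(W) = W`.  None of this is proved here; the definition is the
characterising set of Thm. 15.1.5. [cite: BrinonConrad2009, Thm. 15.1.2 and Thm. 15.1.5] -/
def DSen : Submodule E (M ⊗[ℚ_[p]] (cPeriodRingData F p).B) :=
  finiteVectors ((cPeriodRingData F p).coeffTensorRep ρ) (kerCyclotomic F p)

/-- Membership in `D_Sen`. [folklore] -/
lemma mem_DSen_iff (x : M ⊗[ℚ_[p]] (cPeriodRingData F p).B) :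
    x ∈ DSen p ρ ↔ (∀ h ∈ kerCyclotomic F p, (cPeriodRingData F p).coeffTensorRep ρ h x = x) ∧
      FiniteDimensional E (orbitSpan ((cPeriodRingData F p).coeffTensorRep ρ) x) :=
  Iff.rfl

/-- **`D_ℂ(V) = (ℂ_F ⊗ V)^{Γ_F} ⊆ D_Sen(ℂ_F ⊗ V)`**: invariant tensors are finite vectors.
[folklore] -/
lemma coeffD_le_DSen : (cPeriodRingData F p).coeffD ρ ≤ DSen p ρ :=
  fun _ hx => mem_finiteVectors_of_forall_eq _ _ hx

/-- The **difference quotient** `(χ_F(g) - 1)⁻¹ • (g x - x)` of the diagonal action on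
`W = M ⊗_{ℚ_p} ℂ_F` along the cyclotomic character (for `χ_F(g) ≠ 1`).  Sen's formula
(Brinon–Conrad (15.1.3)) is `Θ(x) = lim_{γ → 1} (γ x - x)/log χ(γ)` on `D_Sen`; since
`log(u)/(u - 1) → 1` as `u → 1` in `ℤ_pˣ`, the limit of this quotient as `g → 1` is the same.
[cite: BrinonConrad2009, (15.1.3)] -/
def diffQuot (x : M ⊗[ℚ_[p]] (cPeriodRingData F p).B) (g : absoluteGaloisGroup F) :
    M ⊗[ℚ_[p]] (cPeriodRingData F p).B :=
  (chiQ F p g - 1)⁻¹ • ((cPeriodRingData F p).coeffTensorRep ρ g x - x)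

/-- The difference quotient of an invariant tensor vanishes. [folklore] -/
lemma diffQuot_eq_zero_of_forall_eq {x : M ⊗[ℚ_[p]] (cPeriodRingData F p).B}
    (hx : ∀ g : absoluteGaloisGroup F, (cPeriodRingData F p).coeffTensorRep ρ g x = x)
    (g : absoluteGaloisGroup F) : diffQuot p ρ x g = 0 := by
  rw [diffQuot, hx g, sub_self, smul_zero]

end Sen

variable {p} in
/-- **Sen's characterisation of the operator `Θ`.**  An `E`-linear, `ℂ_F`-linear endomorphism
`Θ` of `W = M ⊗_{ℚ_p} ℂ_F` IS A SEN OPERATOR for `ρ` when, for every finite vector `x ∈ D_Sen(W)`,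
`Θ x` is the derivative at `g = 1` of the orbit map along the cyclotomic character:
`(χ_F(g) - 1)⁻¹ (g x - x) → Θ x` as `g → 1` in `Γ_F` with `χ_F(g) ≠ 1` — Brinon–Conrad (15.1.3),
`Θ_{D_Sen}(x) = lim_{γ → 1} (γ(x) - x)/log χ(γ)`, the derivative of Sen's defining identity
`γ(x) = exp(log χ(γ) · Θ)(x)` for `γ` near `1` (Thm. 15.1.7; originally Sen 1980), with `log χ(γ)`
replaced by the asymptotically equal `χ(γ) - 1`.  The limit is taken in the WEAK sense — after
every `E`-linear functional `W → E` — which on the finite-dimensional `E`-span of the orbit of `x`,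
where the quotients live, is ordinary convergence of coordinates (no topology on the tensor
product is needed).  By Sen's theorems (`SenOperatorExistsUnique`): the `ℂ_F`-linear extension of
`Θ_{D_Sen(W)}` satisfies this, and it is the only such `Θ` because `D_Sen(W)` spans `W` over `ℂ_F`
(Thm. 15.1.2). [cite: BrinonConrad2009, Thm. 15.1.7 and (15.1.3)] -/
def IsSenOperator (Θ : Sen.endC F p E M) : Prop :=
  ∀ x ∈ Sen.DSen p ρ, ∀ l : M ⊗[ℚ_[p]] (cPeriodRingData F p).B →ₗ[E] E,
    Tendsto (fun g => l (Sen.diffQuot p ρ x g)) (𝓝[{g | Sen.chiQ F p g ≠ 1}] 1)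
      (𝓝 (l ((Θ : Module.End E (M ⊗[ℚ_[p]] (cPeriodRingData F p).B)) x)))

/-- **Sen's operator `Θ = Θ_{Sen}(ρ)`** on `W = M ⊗_{ℚ_p} ℂ_F` (an `E`-linear, `ℂ_F`-linear
endomorphism), PINNED BY SPECIFICATION: Hilbert's `ε` over Sen's characterisation `IsSenOperator`
(as the tree pins Fontaine's datum `fontainePst`).  Under Sen's theorem `SenOperatorExistsUnique`
(existence and uniqueness of an operator with the characterising property — Sen 1980;
Brinon–Conrad Thm. 15.1.2, 15.1.5, 15.1.7) this IS Sen's operator (`isSenOperator_senOperator`,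
`IsSenOperator.eq_senOperator`); nothing else about it is provable or refutable.  Its
characteristic polynomial on `D_Sen` has coefficients in `F` and its eigenvalues are the
generalized Hodge–Tate (Sen) weights; `W` is Hodge–Tate iff `Θ` is semisimple with integer
eigenvalues, and `Θ = 0` iff `W` is trivial (Brinon–Conrad Cor. 15.1.10, Exercise 15.5.4).
[cite: BrinonConrad2009, Thm. 15.1.7] -/
def senOperator : Sen.endC F p E M :=
  Classical.epsilon (IsSenOperator ρ)

/-- Sen's operator as an `E`-linear endomorphism of `W = M ⊗_{ℚ_p} ℂ_F` (coercion of
`senOperator`). [folklore] -/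
def senEnd : Module.End E (M ⊗[ℚ_[p]] (cPeriodRingData F p).B) :=
  ((senOperator p ρ : Sen.endC F p E M) : Module.End E (M ⊗[ℚ_[p]] (cPeriodRingData F p).B))

/-- `senEnd` is the coercion of `senOperator`. [folklore] -/
lemma senEnd_def : senEnd p ρ =
    ((senOperator p ρ : Sen.endC F p E M) : Module.End E (M ⊗[ℚ_[p]] (cPeriodRingData F p).B)) :=
  rfl

/-- Sen's operator commutes with the `ℂ_F`-action (by construction it lies in `Sen.endC`).
[folklore] -/
lemma ringAct_mul_senEnd (b : (cPeriodRingData F p).B) :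
    (cPeriodRingData F p).ringAct E M b * senEnd p ρ =
      senEnd p ρ * (cPeriodRingData F p).ringAct E M b :=
  (Sen.mem_endC_iff _).1 (senOperator p ρ).2 b

/-- If some operator has Sen's property, so does `senOperator ρ` (Hilbert's `ε`). [folklore] -/
lemma isSenOperator_senOperator_of_exists (h : ∃ Θ : Sen.endC F p E M, IsSenOperator ρ Θ) :
    IsSenOperator ρ (senOperator p ρ) :=
  Classical.epsilon_spec h

/-! ### Labelled Sen conditions -/

section Labelled

variable (τ : F →+* E)

/-- Sen's operator preserves the `τ`-component `W_τ` of `W = M ⊗_{ℚ_p} ℂ_F`. [folklore] -/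
lemma senEnd_mem_labelComponent {x : M ⊗[ℚ_[p]] (cPeriodRingData F p).B}
    (hx : x ∈ (cPeriodRingData F p).labelComponent E M τ) :
    senEnd p ρ x ∈ (cPeriodRingData F p).labelComponent E M τ :=
  PeriodRingData.map_mem_labelComponent E M _ (ringAct_mul_senEnd p ρ) τ hx

/-- **`Θ_τ`, the `τ`-component of Sen's operator**: the restriction of `Θ` to the `τ`-component
`W_τ = {x | (id ⊗ f) x = τ(f) • x}` of `W = M ⊗_{ℚ_p} ℂ_F`, for an embedding `τ : F →+* E`
(intended: `ℚ_p`-linear, e.g. continuous; for other `τ` one has `W_τ = 0`).  When `E` contains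
the embeddings of `F`, `W = ⊕_τ W_τ` and `Θ = ⊕_τ Θ_τ`; the eigenvalues of `Θ_τ` are the
`τ`-labelled Hodge–Tate–Sen weights (Patrikis 2019, §2.7.1; Buzzard–Gee 2014, Rem. 3.2.3).
[cite: BrinonConrad2009, Thm. 15.1.7] [cite: Patrikis2019, §2.7.1] -/
def senOperatorAt : Module.End E ((cPeriodRingData F p).labelComponent E M τ) :=
  (senEnd p ρ).restrict fun _ hx => senEnd_mem_labelComponent p ρ τ hx

/-- Unfolding lemma for `senOperatorAt`. [folklore] -/
@[simp] lemma senOperatorAt_apply_coe (x : (cPeriodRingData F p).labelComponent E M τ) :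
    (senOperatorAt p ρ τ x : M ⊗[ℚ_[p]] (cPeriodRingData F p).B) = senEnd p ρ x := rfl

/-- **`ρ` is Sen-null** (`Θ = 0` on all of `W = M ⊗_{ℚ_p} ℂ_F`): by Sen, `W` is a trivial
`ℂ_F`-semilinear representation, i.e. `ρ` is `ℂ`-admissible (Brinon–Conrad Ex. 15.5.4 (2) with
`r = 0`), i.e. (Sen 1973, `SenFiniteness`) the inertia group acts through a finite quotient.
[cite: BrinonConrad2009, Exercise 15.5.4] -/
def IsSenNull (ρ : GaloisRep F E M) : Prop := senEnd p ρ = 0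

/-- **`ρ` is Sen-null at `τ`** (`Θ_τ = 0`): Sen's operator kills the `τ`-component `W_τ`.
This is "Hodge–Tate at `τ` with all `τ`-weights `0`"; after a twist making the `τ`-weights `0`
it expresses `τ`-Hodge–Tate-ness with a single repeated weight. [cite: BrinonConrad2009, Exercise 15.5.4] -/
def IsSenNullAt (ρ : GaloisRep F E M) (τ : F →+* E) : Prop :=
  ∀ x ∈ (cPeriodRingData F p).labelComponent E M τ, senEnd p ρ x = 0

/-- `IsSenNullAt ρ τ ↔ Θ_τ = 0`. [folklore] -/
lemma isSenNullAt_iff_senOperatorAt_eq_zero : IsSenNullAt p ρ τ ↔ senOperatorAt p ρ τ = 0 := by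
  constructor
  · intro h
    ext x
    rw [senOperatorAt_apply_coe, h x x.2, LinearMap.zero_apply, Submodule.coe_zero]
  · intro h x hx
    have hx' : ((senOperatorAt p ρ τ ⟨x, hx⟩ : (cPeriodRingData F p).labelComponent E M τ) :
        M ⊗[ℚ_[p]] (cPeriodRingData F p).B) = 0 := by
      rw [h, LinearMap.zero_apply, Submodule.coe_zero]
    rwa [senOperatorAt_apply_coe] at hx'

/-- Sen-null implies Sen-null at every `τ`. [folklore] -/
lemma IsSenNull.isSenNullAt (h : IsSenNull p ρ) (τ : F →+* E) : IsSenNullAt p ρ τ := by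
  intro x _
  rw [IsSenNull] at h
  rw [h, LinearMap.zero_apply]

/-- **`ρ` is Hodge–Tate at `τ`**: Sen's operator is semisimple with integer eigenvalues on the
`τ`-component, i.e. `W_τ` is contained in (equivalently, since `Θ` preserves `W_τ` and eigen-
components are polynomials in `Θ`, is the direct sum of its intersections with) the eigenspaces
`ker(Θ - i)`, `i ∈ ℤ`.  For `W` itself: `W` is Hodge–Tate (`≅ ⊕ ℂ_F(χ^{r_i})`, `r_i ∈ ℤ`) iff `Θ`
is semisimple with integer eigenvalues (Brinon–Conrad Ex. 15.5.4 (3); Berger 2004 §2, "clearly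
equivalent to `Θ_V` being diagonalizable with integer eigenvalues").
[cite: BrinonConrad2009, Exercise 15.5.4] -/
def IsHodgeTateAt (ρ : GaloisRep F E M) (τ : F →+* E) : Prop :=
  (cPeriodRingData F p).labelComponent E M τ ≤ ⨆ i : ℤ, Module.End.eigenspace (senEnd p ρ) (i : E)

/-- The **`τ`-labelled Hodge–Tate–Sen weights** of `ρ` AS A SET: the eigenvalues of Sen's
operator on the `τ`-component `W_τ` (`a ∈ E` with `ker(Θ - a) ∩ W_τ ≠ 0`).  For de Rham (or
Hodge–Tate) `ρ` these are the members of `labelledHodgeTateWeights` (as integers of `E`);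
multiplicities (the Sen polynomial `det(X - Θ_τ)`) are not provided here.
[cite: Patrikis2019, §2.7.1] [cite: BrinonConrad2009, Exercise 15.5.3] -/
def senWeightsAt : Set E :=
  {a | (cPeriodRingData F p).labelComponent E M τ ⊓ Module.End.eigenspace (senEnd p ρ) a ≠ ⊥}

/-- Membership in `senWeightsAt`: `a` is an eigenvalue of `Θ` with an eigenvector in `W_τ`.
[folklore] -/
lemma mem_senWeightsAt_iff (a : E) :
    a ∈ senWeightsAt p ρ τ ↔
      ∃ x ∈ (cPeriodRingData F p).labelComponent E M τ, x ≠ 0 ∧ senEnd p ρ x = a • x := by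
  rw [senWeightsAt, Set.mem_setOf_eq, Submodule.ne_bot_iff]
  constructor
  · rintro ⟨x, ⟨hx, hx'⟩, hx0⟩
    exact ⟨x, hx, hx0, Module.End.mem_eigenspace_iff.1 hx'⟩
  · rintro ⟨x, hx, hx0, hx'⟩
    exact ⟨x, ⟨hx, Module.End.mem_eigenspace_iff.2 hx'⟩, hx0⟩

/-- A Sen-null-at-`τ` representation is Hodge–Tate at `τ` (all of `W_τ` is the `0`-eigenspace).
[folklore] -/
lemma IsSenNullAt.isHodgeTateAt (h : IsSenNullAt p ρ τ) : IsHodgeTateAt p ρ τ := by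
  intro x hx
  refine Submodule.mem_iSup_of_mem 0 ?_
  rw [Module.End.mem_eigenspace_iff, h x hx, Int.cast_zero, zero_smul]

/-- `0` is the only weight of a Sen-null-at-`τ` representation. [folklore] -/
lemma IsSenNullAt.senWeightsAt_subset (h : IsSenNullAt p ρ τ) : senWeightsAt p ρ τ ⊆ {0} := by
  intro a ha
  obtain ⟨x, hx, hx0, hxa⟩ := (mem_senWeightsAt_iff p ρ τ a).1 ha
  rw [h x hx] at hxa
  rw [Set.mem_singleton_iff]
  by_contra ha0
  exact hx0 ((smul_eq_zero_iff_right ha0).1 hxa.symm)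

end Labelled

end Sen

/-! ### Consequences of the characterisation -/

section Consequences

variable {F : Type} [Field F] [ValuativeRel F] [TopologicalSpace F] [IsNonarchimedeanLocalField F]
  [CharZero F] (p : ℕ) [Fact p.Prime] [Algebra ℚ_[p] F]
  {E : Type*} [Field E] [Algebra ℚ_[p] E] [TopologicalSpace E]
  {M : Type*} [AddCommGroup M] [Module E M] [Module ℚ_[p] M] [IsScalarTower ℚ_[p] E M]
  [TopologicalSpace M] (ρ : GaloisRep F E M)

/-- **A Sen operator kills the invariants `D_ℂ(V) = W^{Γ_F}`** (the easy half of
Brinon–Conrad Ex. 15.5.4 (1): `ker Θ = W^{G_K}` on `W^{H}`-finite vectors): on an invariant tensor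
all difference quotients vanish, so every functional of `Θ x` is a limit of `0`.  Hypotheses: `E`
is `T₁` (limits are unique) and `1` is an accumulation point of `{g | χ_F(g) ≠ 1}` in `Γ_F`
(`χ_F` is not locally constant at `1` — true as `F(μ_{p^∞})/F` is infinite; supplied by the user).
[cite: BrinonConrad2009, Exercise 15.5.4 and Cor. 15.1.10] -/
theorem IsSenOperator.apply_eq_zero_of_mem_coeffD [T1Space E]
    [(𝓝[{g | Sen.chiQ F p g ≠ 1}] (1 : absoluteGaloisGroup F)).NeBot]
    {Θ : Sen.endC F p E M} (hΘ : IsSenOperator ρ Θ)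
    {x : M ⊗[ℚ_[p]] (cPeriodRingData F p).B} (hx : x ∈ (cPeriodRingData F p).coeffD ρ) :
    (Θ : Module.End E (M ⊗[ℚ_[p]] (cPeriodRingData F p).B)) x = 0 := by
  refine (Module.forall_dual_apply_eq_zero_iff E _).1 fun l => ?_
  have ht := hΘ x (Sen.coeffD_le_DSen p ρ hx) l
  have h0 : (fun g => l (Sen.diffQuot p ρ x g)) = fun _ => (0 : E) := by
    funext g
    rw [Sen.diffQuot_eq_zero_of_forall_eq p ρ hx, map_zero]
  rw [h0] at ht
  exact (tendsto_const_nhds_iff.1 ht).symm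

/-- Hence, if Sen's operator has Sen's property (e.g. under `SenOperatorExistsUnique`), it kills
`D_ℂ(V)`; in particular a `ℂ`-admissible `τ`-component is Sen-null. [folklore] -/
theorem senEnd_apply_eq_zero_of_mem_coeffD [T1Space E]
    [(𝓝[{g | Sen.chiQ F p g ≠ 1}] (1 : absoluteGaloisGroup F)).NeBot]
    (h : IsSenOperator ρ (senOperator p ρ))
    {x : M ⊗[ℚ_[p]] (cPeriodRingData F p).B} (hx : x ∈ (cPeriodRingData F p).coeffD ρ) :
    senEnd p ρ x = 0 :=
  h.apply_eq_zero_of_mem_coeffD p ρ hx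

end Consequences

/-! ### Sen's theorems as named facts (D-0014) -/

section Facts

/-- **Sen's theorem (existence and uniqueness of the Sen operator), `ℚ̄_p`-coefficients.**  For a
non-archimedean local field `F` of characteristic `0` and residue characteristic `p` (with its
canonical `ℚ_p`-algebra structure `LocalField.padicAlgebra`) and a continuous representation
`r : Γ_F → GL_n(ℚ̄_p)`, there is exactly one `ℚ̄_p`-linear, `ℂ_F`-linear endomorphism `Θ` of
`W = ℚ̄_p^n ⊗_{ℚ_p} ℂ_F` with Sen's property `IsSenOperator` (the derivative formula on the finite
vectors).  PRINTED FORM (Brinon–Conrad, after Sen 1980), for `V` finite-dimensional over `ℚ_p`: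
Thm. 15.1.2 (existence and uniqueness of the `K_∞`-structure `D_Sen(W)` with
`ℂ_K ⊗_{K_∞} D_Sen(W) = W`), Thm. 15.1.5 (`D_Sen` = finite vectors of `W^H`), Thm. 15.1.7 (existence
and uniqueness of `Θ` on `D_Sen`) and formula (15.1.3) (the limit); Berger 2004 §2 ("Sen's
theory": `D_Sen(V)`, `Θ_V = log(γ)/log_p χ(γ)`).  The `ℚ̄_p`-form follows by the standard
reduction to a model over a finite `E₀/ℚ_p` containing the compact image `r(Γ_F)` (Baire), for
which `W = W_{E₀} ⊗_{E₀} ℚ̄_p`, `D_Sen(W) = D_Sen(W_{E₀}) ⊗_{E₀} ℚ̄_p` and `Θ = Θ_{E₀} ⊗ 1`.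
Discharging this fact is formalising Sen's decompletion (Tate's normalised traces are in the
tree, `TateNormalizedTrace`). [cite: BrinonConrad2009, Thm. 15.1.2, Thm. 15.1.5, Thm. 15.1.7 and (15.1.3)]
[cite: BergerLaurent2004Introduction, §2 (Sen's theory)] [cite: Sen1980, original source (not consulted, acq-06291)] -/
def SenOperatorExistsUnique : Prop :=
  ∀ (F : Type) [Field F] [ValuativeRel F] [TopologicalSpace F] [IsNonarchimedeanLocalField F]
    [CharZero F] (p : ℕ) [Fact p.Prime] (hp : valuation F p < 1) (n : ℕ)
    (r : FramedGaloisRep F (PadicAlgCl p) n),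
    letI := LocalField.padicAlgebra F p hp
    ∃! Θ : Sen.endC F p (PadicAlgCl p) (Fin n → PadicAlgCl p), IsSenOperator r.toGaloisRep Θ

/-- **Sen's finiteness theorem** (Sen 1973): for a continuous `r : Γ_F → GL_n(ℚ̄_p)` (`F` as
above), Sen's operator vanishes — `Θ = 0` on `ℚ̄_p^n ⊗_{ℚ_p} ℂ_F`, `IsSenNull` — if and only if
the image of the inertia group `I_F = absInertia F` under `r` is finite.  PRINTED FORM: `Θ = 0`
iff `W = ℂ ⊗ V` is a trivial `ℂ`-semilinear representation, i.e. `V` is `ℂ`-admissible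
(Brinon–Conrad Ex. 15.5.4 (2) with `r = 0`, Cor. 15.1.10 (2); Berger 2004 §2), and `V` is
`ℂ`-admissible iff the inertia group `I_F` acts on `V` through a finite quotient (Berger 2004 §1:
a theorem of Sen, 1973, answering a question of Serre; the character case is Brinon–Conrad
Thm. 2.2.7 (Tate–Sen)).  Stated for the pinned operator `senOperator`, so that it presupposes
`SenOperatorExistsUnique` for its meaning.
[cite: BergerLaurent2004Introduction, §1 (Fontaine's strategy: C_p-admissible iff potentially unramified) and §2 (Sen's theory)]
[cite: BrinonConrad2009, Cor. 15.1.10, Exercise 15.5.4 and Thm. 2.2.7]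
[cite: Sen1973, original source (not consulted, acq-06283)] -/
def SenFiniteness : Prop :=
  ∀ (F : Type) [Field F] [ValuativeRel F] [TopologicalSpace F] [IsNonarchimedeanLocalField F]
    [CharZero F] (p : ℕ) [Fact p.Prime] (hp : valuation F p < 1) (n : ℕ)
    (r : FramedGaloisRep F (PadicAlgCl p) n),
    letI := LocalField.padicAlgebra F p hp
    IsSenNull p r.toGaloisRep ↔
      ((fun g => r g) '' (absInertia F : Set (absoluteGaloisGroup F))).Finite

variable {F : Type} [Field F] [ValuativeRel F] [TopologicalSpace F] [IsNonarchimedeanLocalField F]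
  [CharZero F] {p : ℕ} [Fact p.Prime]

/-- Under Sen's theorem, the pinned operator has Sen's property. [folklore] -/
theorem isSenOperator_senOperator (h : SenOperatorExistsUnique) (hp : valuation F p < 1) {n : ℕ}
    (r : FramedGaloisRep F (PadicAlgCl p) n) :
    letI := LocalField.padicAlgebra F p hp
    IsSenOperator r.toGaloisRep (senOperator p r.toGaloisRep) := by
  letI := LocalField.padicAlgebra F p hp
  exact isSenOperator_senOperator_of_exists p _ (h F p hp n r).exists

/-- Under Sen's theorem, any operator with Sen's property IS the pinned operator. [folklore] -/
theorem IsSenOperator.eq_senOperator (h : SenOperatorExistsUnique) (hp : valuation F p < 1)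
    {n : ℕ} (r : FramedGaloisRep F (PadicAlgCl p) n) :
    letI := LocalField.padicAlgebra F p hp
    ∀ Θ : Sen.endC F p (PadicAlgCl p) (Fin n → PadicAlgCl p),
      IsSenOperator r.toGaloisRep Θ → Θ = senOperator p r.toGaloisRep := by
  letI := LocalField.padicAlgebra F p hp
  intro Θ hΘ
  exact (h F p hp n r).unique hΘ (isSenOperator_senOperator h hp r)

/-- Under `SenFiniteness`: finite inertia image ⇒ Sen-null at every `τ`. [folklore] -/
theorem isSenNullAt_of_finite_image_inertia (h : SenFiniteness) (hp : valuation F p < 1) {n : ℕ}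
    (r : FramedGaloisRep F (PadicAlgCl p) n)
    (hfin : ((fun g => r g) '' (absInertia F : Set (absoluteGaloisGroup F))).Finite)
    (τ : F →+* PadicAlgCl p) :
    letI := LocalField.padicAlgebra F p hp
    IsSenNullAt p r.toGaloisRep τ := by
  letI := LocalField.padicAlgebra F p hp
  exact ((h F p hp n r).2 hfin).isSenNullAt p _ τ

end Facts

end Literature.NumberTheory.PAdicHodge

/-! ### Global wrappers: `Θ_τ(ρ|_{Γ_{K_v}})` for `ρ : Γ_K →ₜ* GL_n(ℚ̄_ℓ)` at a place `v` -/

namespace Literature.NumberTheory.GaloisRepresentations.FramedGaloisRep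

open Literature.NumberTheory.PAdicHodge
open scoped NumberField

variable {K : Type} [Field K] [NumberField K] {ℓ : ℕ} [Fact ℓ.Prime] {n : ℕ}

/-- The `τ`-component `W_τ` of `W = ℚ̄_ℓ^n ⊗_{ℚ_ℓ} ℂ_{K_v}` for `τ : K_v →+* ℚ̄_ℓ` and the
`ℚ_ℓ`-structure `alg` of `K_v` (a `ℚ̄_ℓ`-subspace; `PeriodRingData.labelComponent` of the datum
`cPeriodRingData K_v ℓ`). [cite: Patrikis2019, §2.3.1] -/
def senComponentAt (v : HeightOneSpectrum (𝓞 K)) (alg : Algebra ℚ_[ℓ] (v.adicCompletion K))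
    (τ : v.adicCompletion K →+* PadicAlgCl ℓ) :
    letI := alg
    haveI := LocalField.charZero_adicCompletion v
    Submodule (PadicAlgCl ℓ)
      ((Fin n → PadicAlgCl ℓ) ⊗[ℚ_[ℓ]] (cPeriodRingData (v.adicCompletion K) ℓ).B) :=
  letI := alg
  haveI := LocalField.charZero_adicCompletion v
  (cPeriodRingData (v.adicCompletion K) ℓ).labelComponent (PadicAlgCl ℓ) (Fin n → PadicAlgCl ℓ) τ

/-- **`Θ_τ(ρ|_{Γ_{K_v}})`, Sen's operator of `ρ : Γ_K →ₜ* GL_n(ℚ̄_ℓ)` at the finite place `v`,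
`τ`-component**: the restriction to `W_τ` of Sen's operator `Θ` (pinned by Sen's characterisation,
`PAdicHodge.senOperator`; meaningful under `PAdicHodge.SenOperatorExistsUnique`) of the local
representation `ρ|_{Γ_{K_v}} = ρ.toLocal v` on `W = ℚ̄_ℓ^n ⊗_{ℚ_ℓ} ℂ_{K_v}`, for the
`ℚ_ℓ`-structure `alg` of `K_v` (intended: `LocalField.adicCompletionPadicAlgebra v ℓ hv`, `v ∣ ℓ`)
and `τ : K_v →+* ℚ̄_ℓ` (intended: continuous).  Its eigenvalues are the `τ`-labelled
Hodge–Tate–Sen weights of `ρ` at `v` (Buzzard–Gee Rem. 3.2.3, Patrikis §2.7.1).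
[cite: BrinonConrad2009, Thm. 15.1.7] [cite: BuzzardGeeLMS2014, Rem. 3.2.3] -/
def senOperatorAt (ρ : FramedGaloisRep K (PadicAlgCl ℓ) n) (v : HeightOneSpectrum (𝓞 K))
    (alg : Algebra ℚ_[ℓ] (v.adicCompletion K)) (τ : v.adicCompletion K →+* PadicAlgCl ℓ) :
    Module.End (PadicAlgCl ℓ) (senComponentAt (n := n) v alg τ) :=
  letI := alg
  haveI := LocalField.charZero_adicCompletion v
  PAdicHodge.senOperatorAt ℓ (ρ.toLocal v).toGaloisRep τ

/-- Unfolding lemma for `senOperatorAt`. [folklore] -/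
lemma senOperatorAt_def (ρ : FramedGaloisRep K (PadicAlgCl ℓ) n) (v : HeightOneSpectrum (𝓞 K))
    (alg : Algebra ℚ_[ℓ] (v.adicCompletion K)) (τ : v.adicCompletion K →+* PadicAlgCl ℓ) :
    ρ.senOperatorAt v alg τ =
      (letI := alg; haveI := LocalField.charZero_adicCompletion v
       PAdicHodge.senOperatorAt ℓ (ρ.toLocal v).toGaloisRep τ) :=
  rfl

/-- **`ρ` is Sen-null at the place `v`**: Sen's operator of `ρ|_{Γ_{K_v}}` vanishes on all of
`W = ℚ̄_ℓ^n ⊗_{ℚ_ℓ} ℂ_{K_v}` (`PAdicHodge.IsSenNull`); by Sen, iff `ρ(I_{K_v})` is finite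
(`isSenNullAtPlace_iff_finite`). [cite: BrinonConrad2009, Exercise 15.5.4]
[cite: BergerLaurent2004Introduction, §1–§2] -/
def IsSenNullAtPlace (ρ : FramedGaloisRep K (PadicAlgCl ℓ) n) (v : HeightOneSpectrum (𝓞 K))
    (alg : Algebra ℚ_[ℓ] (v.adicCompletion K)) : Prop :=
  letI := alg
  haveI := LocalField.charZero_adicCompletion v
  PAdicHodge.IsSenNull ℓ (ρ.toLocal v).toGaloisRep

/-- **`ρ` is Sen-null at `(v, τ)`** (`Θ_τ(ρ|_{Γ_{K_v}}) = 0`: "`τ`-Hodge–Tate with all `τ`-weights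
`0`"; `PAdicHodge.IsSenNullAt`). [cite: BrinonConrad2009, Exercise 15.5.4] -/
def IsSenNullAt (ρ : FramedGaloisRep K (PadicAlgCl ℓ) n) (v : HeightOneSpectrum (𝓞 K))
    (alg : Algebra ℚ_[ℓ] (v.adicCompletion K)) (τ : v.adicCompletion K →+* PadicAlgCl ℓ) : Prop :=
  letI := alg
  haveI := LocalField.charZero_adicCompletion v
  PAdicHodge.IsSenNullAt ℓ (ρ.toLocal v).toGaloisRep τ

/-- **`ρ` is Hodge–Tate at `(v, τ)`**: `Θ_τ(ρ|_{Γ_{K_v}})` is semisimple with integer eigenvalues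
(`PAdicHodge.IsHodgeTateAt`: `W_τ` lies in the sum of the integer eigenspaces of `Θ`).
[cite: BrinonConrad2009, Exercise 15.5.4] [cite: BergerLaurent2004Introduction, §2 (Sen's theory)] -/
def IsHodgeTateAt (ρ : FramedGaloisRep K (PadicAlgCl ℓ) n) (v : HeightOneSpectrum (𝓞 K))
    (alg : Algebra ℚ_[ℓ] (v.adicCompletion K)) (τ : v.adicCompletion K →+* PadicAlgCl ℓ) : Prop :=
  letI := alg
  haveI := LocalField.charZero_adicCompletion v
  PAdicHodge.IsHodgeTateAt ℓ (ρ.toLocal v).toGaloisRep τ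

/-- The **`τ`-labelled Hodge–Tate–Sen weights of `ρ` at `v`** as a set: the eigenvalues of
`Θ_τ(ρ|_{Γ_{K_v}})` in `ℚ̄_ℓ` (`PAdicHodge.senWeightsAt`; multiplicities not provided).  For de
Rham `ρ` these are the members of `labelledHodgeTateWeightsAt` (Buzzard–Gee Rem. 3.2.3).
[cite: Patrikis2019, §2.7.1] [cite: BuzzardGeeLMS2014, Rem. 3.2.3] -/
def senWeightsAt (ρ : FramedGaloisRep K (PadicAlgCl ℓ) n) (v : HeightOneSpectrum (𝓞 K))
    (alg : Algebra ℚ_[ℓ] (v.adicCompletion K)) (τ : v.adicCompletion K →+* PadicAlgCl ℓ) :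
    Set (PadicAlgCl ℓ) :=
  letI := alg
  haveI := LocalField.charZero_adicCompletion v
  PAdicHodge.senWeightsAt ℓ (ρ.toLocal v).toGaloisRep τ

/-- `IsSenNullAt ↔ Θ_τ = 0`. [folklore] -/
lemma isSenNullAt_iff_senOperatorAt_eq_zero (ρ : FramedGaloisRep K (PadicAlgCl ℓ) n)
    (v : HeightOneSpectrum (𝓞 K)) (alg : Algebra ℚ_[ℓ] (v.adicCompletion K))
    (τ : v.adicCompletion K →+* PadicAlgCl ℓ) :
    ρ.IsSenNullAt v alg τ ↔ ρ.senOperatorAt v alg τ = 0 :=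
  letI := alg
  haveI := LocalField.charZero_adicCompletion v
  PAdicHodge.isSenNullAt_iff_senOperatorAt_eq_zero ℓ _ τ

/-- Sen-null at the place `v` implies Sen-null at every `(v, τ)`. [folklore] -/
lemma IsSenNullAtPlace.isSenNullAt {ρ : FramedGaloisRep K (PadicAlgCl ℓ) n}
    {v : HeightOneSpectrum (𝓞 K)} {alg : Algebra ℚ_[ℓ] (v.adicCompletion K)}
    (h : ρ.IsSenNullAtPlace v alg) (τ : v.adicCompletion K →+* PadicAlgCl ℓ) :
    ρ.IsSenNullAt v alg τ :=
  letI := alg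
  haveI := LocalField.charZero_adicCompletion v
  PAdicHodge.IsSenNull.isSenNullAt ℓ _ h τ

/-- Sen-null at `(v, τ)` implies Hodge–Tate at `(v, τ)`. [folklore] -/
lemma IsSenNullAt.isHodgeTateAt {ρ : FramedGaloisRep K (PadicAlgCl ℓ) n}
    {v : HeightOneSpectrum (𝓞 K)} {alg : Algebra ℚ_[ℓ] (v.adicCompletion K)}
    {τ : v.adicCompletion K →+* PadicAlgCl ℓ} (h : ρ.IsSenNullAt v alg τ) :
    ρ.IsHodgeTateAt v alg τ :=
  letI := alg
  haveI := LocalField.charZero_adicCompletion v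
  PAdicHodge.IsSenNullAt.isHodgeTateAt ℓ _ τ h

/-- Sen-null at `(v, τ)` forces `0` to be the only `τ`-weight. [folklore] -/
lemma IsSenNullAt.senWeightsAt_subset {ρ : FramedGaloisRep K (PadicAlgCl ℓ) n}
    {v : HeightOneSpectrum (𝓞 K)} {alg : Algebra ℚ_[ℓ] (v.adicCompletion K)}
    {τ : v.adicCompletion K →+* PadicAlgCl ℓ} (h : ρ.IsSenNullAt v alg τ) :
    ρ.senWeightsAt v alg τ ⊆ {0} :=
  letI := alg
  haveI := LocalField.charZero_adicCompletion v
  PAdicHodge.IsSenNullAt.senWeightsAt_subset ℓ _ τ h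

/-- **Sen's finiteness theorem at `v ∣ ℓ`** (from the named fact `PAdicHodge.SenFiniteness`), for
the canonical `ℚ_ℓ`-structure `LocalField.adicCompletionPadicAlgebra v ℓ hv` of `K_v`:
`Θ(ρ|_{Γ_{K_v}}) = 0` if and only if the image of the inertia group `I_{K_v} = absInertia K_v`
under `ρ|_{Γ_{K_v}}` is finite. [cite: BergerLaurent2004Introduction, §1–§2]
[cite: Sen1973, original source (not consulted)] -/
theorem isSenNullAtPlace_iff_finite (h : SenFiniteness) (ρ : FramedGaloisRep K (PadicAlgCl ℓ) n)
    (v : HeightOneSpectrum (𝓞 K)) (hv : ((ℓ : ℕ) : 𝓞 K) ∈ v.asIdeal) :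
    ρ.IsSenNullAtPlace v (LocalField.adicCompletionPadicAlgebra v ℓ hv) ↔
      ((fun g => ρ.toLocal v g) ''
        (absInertia (v.adicCompletion K) : Set (absoluteGaloisGroup (v.adicCompletion K)))).Finite :=
  haveI := LocalField.charZero_adicCompletion v
  h (v.adicCompletion K) ℓ (LocalField.valuation_adicCompletion_natCast_lt_one v ℓ hv) n (ρ.toLocal v)

/-- **Finite inertia image at `v ∣ ℓ` ⇒ Sen-null at every `(v, τ)`** (under `SenFiniteness`), for
the canonical `ℚ_ℓ`-structure of `K_v`. [cite: BergerLaurent2004Introduction, §1–§2] -/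
theorem isSenNullAt_of_finite (h : SenFiniteness) (ρ : FramedGaloisRep K (PadicAlgCl ℓ) n)
    (v : HeightOneSpectrum (𝓞 K)) (hv : ((ℓ : ℕ) : 𝓞 K) ∈ v.asIdeal)
    (hfin : ((fun g => ρ.toLocal v g) ''
      (absInertia (v.adicCompletion K) : Set (absoluteGaloisGroup (v.adicCompletion K)))).Finite)
    (τ : v.adicCompletion K →+* PadicAlgCl ℓ) :
    ρ.IsSenNullAt v (LocalField.adicCompletionPadicAlgebra v ℓ hv) τ :=
  ((isSenNullAtPlace_iff_finite h ρ v hv).2 hfin).isSenNullAt τ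

end Literature.NumberTheory.GaloisRepresentations.FramedGaloisRep


end
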